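import Summits.BirchSwinnertonDyer.BirchSwinnertonDyer.Theorems.KatoDescentPotSupersingularWildFineSelmerCongruenceFact
import Summits.BirchSwinnertonDyer.Rank1Residual.Iwasawa.MuZeroQuotientCard
import Literature.NumberTheory.EllipticCurves.IwasawaLeadingTermOddPrime
import Literature.NumberTheory.EllipticCurves.IwasawaLeadingTermProofs
import Literature.NumberTheory.EllipticCurves.IwasawaOrderOfVanishingProofs
import Literature.NumberTheory.EllipticCurves.IwasawaTowerTorsionOrdinaryProofs
import Literature.NumberTheory.EllipticCurves.SelmerCorankControlRatOrdinaryProofs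
import Literature.NumberTheory.EllipticCurves.IwasawaSelmerControlAwayFromPProofs
import Literature.NumberTheory.EllipticCurves.IwasawaAlgebraMuVanishingProofs
import Literature.NumberTheory.EllipticCurves.LeadingTermPPartProofs
import Literature.NumberTheory.EllipticCurves.MordellWeilRankZeroProofs
import Literature.NumberTheory.EllipticCurves.MordellWeilTheoremProofs
import Literature.NumberTheory.EllipticCurves.LeadingTerm
import Literature.NumberTheory.EllipticCurves.KatoRankBoundSelmerProofs
import HarnessLib

/-!
# Route `KatoDescentPotSupersingular` (rung K9, cell `bsd-potss`): GOOD-ORDINARY UNIT ANCHORS for the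
# congruence road to the Conj-A crux `WildFineSelmerCoatesSujatha` (item stmt-BirchSwinnertonDyer-19386)
# — the KERNEL LINK «Greenberg unit data at `(E′,p)` ⟹ `Sel_{p^∞}(E′/ℚ^cyc)[p]` finite» below the tree's
# named fact `Schneider1985_order_charGenerator_odd` (Perrin-Riou–Schneider; its rank-`0` case is
# Greenberg's Thm. 4.1), and the per-row road «Upper at `W` ⟸ one congruent unit anchor»; ROUTE-FREE
# (a `--supports … --as helper` file; seat `bsd-potss-k9-c4` g4; nothing booked, BSD is not proved
# by any of this, item 19386 is NOT closed)

THE ROAD SO FAR (seat k9-c4 g3: `…WildFineSelmerCongruenceRoad`, `…FineSelmerLeSelmer`,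
`…WildFineSelmerOrdinaryAnchor`, `…WildFineSelmerCongruenceFact`): on a row `W` of the crux (wild `3`,
`r_an = 0`, `W[3]` irreducible, tower not onto), Upper at `(W,3)` ⟸ (A) at `(W,3)` ⟸ [Lim–Sujatha 2018
Prop. 3.2, tree fact p445851] (A) at `(W′,3)` for ONE `W′` with `W′[3] ≃ W[3]` ⟸ [unconditional kernel
theorem `conjA_of_finite_selmerInfty_pTorsion`] `Sel_{3^∞}(W′/ℚ^cyc)[3]` finite. What was missing is
the link from CHECKABLE data at the anchor to that finiteness. THIS FILE supplies it:

* `finite_selmerInfty_pTorsion_of_unitData` — for `W′/ℚ` globally minimal, `p` odd of good ORDINARY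
  reduction, `rank E′(ℚ) = 0`, `Ш(E′/ℚ)[p^∞] = 0`, `p ∤ #E′(ℚ)_tors · ∏ c_ℓ(E′) · #Ẽ′(𝔽_p)` ("Greenberg
  unit data"): `Sel_{p^∞}(E′/ℚ_∞)[p]` is finite for EVERY cyclotomic `ℤ_p`-extension datum `κ` —
  below the ONE named fact `Schneider1985_order_charGenerator_odd` (BMS Thm. 1.7 / Perrin-Riou 1992 /
  Schneider 1985, `p ≠ 2`; rank-`0` case = Greenberg, LNM 1716, Thm. 4.1: `f_E(0) ∼ ∏ c_v^{(p)} ·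
  #Ẽ(𝔽_p)(p)² · #Sel_E(ℚ)_p / #E(ℚ)(p)²`). Chain, all in the kernel: the normalised cyclotomic pair
  `(κ₀, γ₀)` and `X₀ = X(E′/ℚ_∞)` (`selmerDualData`); `Sel_{p^∞}(E′/ℚ)` finite + Greenberg's Lemmas
  3.3/3.4 at `n = 0` ⟹ `X₀` finitely generated `Λ`-torsion (Mazur control); the ZERO height datum is
  canonical and has regulator `1` in rank `0` (no admissible point; empty Mordell–Weil basis); the fact's
  clause 3 reads `f₀(0) · #tors² = u · (1 - α⁻¹)² · #Ш[p^∞] · 1 · Tam` with `1 - α⁻¹ = u₁ · #Ẽ(𝔽_p)`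
  (tree `exists_unit_one_sub_unitRoot_inv`), so `f₀(0) ∈ ℤ_pˣ`; ⟹ `μ(X₀) = 0`
  (`muInvariant_eq_zero_iff_exists_isUnit_coeff_of_charIdeal_eq_span`) ⟹ `X₀` f.g./`ℤ_p` ⟹ `X₀/pX₀`
  finite ⟹ (`X₀ = Hom(Sel_∞, ℚ/ℤ)`, Pontryagin `#(Hom(B,ℚ/ℤ)/p) = #B[p]`) `Sel_∞[p]` finite; transport
  to every cyclotomic `κ` (`ker κ = ker κ₀`).
* `missingUpperBoundAt_wild_of_ordinaryUnitAnchor` — the per-row road: Upper at a row `W` (wild `3`,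
  `r_an = 0`, `W[3]` irreducible) ⟸ {LS18 p445851, Kato fine-Selmer reading p420034,
  Perrin-Riou–Schneider, GZK, modularity} + ONE globally minimal `W′` with `W′[3] ≃ W[3]`
  (`O6.ModPCongruent`), good ordinary at `3`, and the five integers `rank E′(ℚ) = 0`,
  `#Ш(E′)[3^∞] = 1`, `3 ∤ #tors(E′)`, `3 ∤ Tam(E′)`, `3 ∤ #Ẽ′(𝔽₃)` — the CERTIFICATE currency of the
  anchor census (seat `bsd-potss-conjA-anchor`; k8t-c4 g4's K9 census: 29 rows with such an anchor
  at data level, 8 of them ♯ rows).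
* `wildFineSelmerCoatesSujatha_of_unitAnchorCertificates` — the crux BODY from per-row unit-anchor
  certificates (the `hcert` currency), under the same named facts.

CONDITIONAL on the displayed named facts (audit `proof.conditional`); no definition, no new fact, no
census number is an input.

References: [GreenbergLNM1716] §3 Lemmas 3.3–3.4, §4 Thm. 4.1; [BalakrishnanMullerStein2015] Thm. 1.7;
[Schneider1985] Thm. 2′; [PerrinRiou1992] §3.4; [GreenbergVatsal2000] Prop. (2.8); [LimSujatha2018] §3
Prop. 3.2; [CoatesSujatha2005] §3; [Kato2004Asterisque] Thm. 14.5 (3); [Washington1997] §13.1–13.2.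
-/

set_option autoImplicit false
-- sibling precedent (`KatoDescentPotSupersingularAssembly.lean`): the directory name repeats the summit name
set_option linter.dupNamespace false

noncomputable section

open scoped Classical AddSubgroup

universe u

namespace Summit.BirchSwinnertonDyer.BirchSwinnertonDyer.Theorems.WildFineSelmerOrdinaryUnitAnchor

open WeierstrassCurve Literature.NumberTheory.EllipticCurves
  Literature.NumberTheory.EllipticCurves.IwasawaAlgebra
  Literature.NumberTheory.EllipticCurves.Rank1Residual
  Literature.NumberTheory.EllipticCurves.Rank1Residual.Typed
  Summit.BirchSwinnertonDyer.Rank1Residual Summit.BirchSwinnertonDyer.Rank1Residual.Additive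
  Summit.BirchSwinnertonDyer.Rank1Residual.O6
  Summit.BirchSwinnertonDyer.BirchSwinnertonDyer.Theorems

/-! ## §0 Transport of `Sel_∞[p]`-finiteness along `ker κ₀ = ker κ` -/

/-- `Sel_{p^∞}(E/K_∞)` only depends on `K_∞ = K̄^{ker κ}` (`selmerInfty κ = selmerGroupOver p (ker κ)`),
so finiteness of its `p`-torsion transports along an equality of kernels (by `subst`). [folklore] -/
theorem finite_pTorsion_selmerGroupOver_of_eq {K : Type u} [Field K] [NumberField K]
    (W : WeierstrassCurve K) {p : ℕ} [Fact p.Prime]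
    {H₀ H : Subgroup (Field.absoluteGaloisGroup K)} [H₀.Normal] [H.Normal] (h : H₀ = H)
    (hfin : Set.Finite {s : W.selmerGroupOver p H₀ | p • s = 0}) :
    Set.Finite {s : W.selmerGroupOver p H | p • s = 0} := by
  subst h
  exact hfin

/-! ## §1 Greenberg unit data ⟹ `Sel_{p^∞}(E/ℚ_∞)[p]` finite -/

/-- **Greenberg's unit criterion, in the kernel below Perrin-Riou–Schneider.** Let `E/ℚ` be given by a
globally minimal `W`, `p` an ODD prime of good ordinary reduction (`p ∤ a_p`), and assume the "unit
data": `rank E(ℚ) = 0`, `#Ш(E/ℚ)[p^∞] = 1`, `p ∤ #E(ℚ)_tors`, `p ∤ ∏_ℓ c_ℓ(E)`, `p ∤ #Ẽ(𝔽_p)`. Then for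
every cyclotomic `ℤ_p`-extension datum `κ`, the `p`-torsion `Sel_{p^∞}(E/ℚ_∞)[p]` is finite (indeed
`X(E/ℚ_∞)` is finitely generated over `ℤ_p`, `μ = 0`; Greenberg: `f_E(0)` is a unit, so `Sel_E(ℚ_∞)_p = 0`).
Proof: see the module docstring — the rank-`0` case of the named fact
`Schneider1985_order_charGenerator_odd` (hypothesis `hPRS`) evaluated at the zero height datum (canonical
and of regulator `1` in rank `0`), Mazur control at level `0` (tree: Greenberg Lemmas 3.3/3.4), the unit
`(1 - α⁻¹)/#Ẽ(𝔽_p)`, `μ = 0 ⟺` a unit coefficient, and Pontryagin `#(X/pX) = #Sel_∞[p]`.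
[cite: GreenbergLNM1716, §4 Thm. 4.1 (p. 85) and §1 p. 60] [cite: BalakrishnanMullerStein2015, Thm. 1.7]
[cite: GreenbergVatsal2000, §2 Prop. (2.8)] -/
theorem finite_selmerInfty_pTorsion_of_unitData (hPRS : Schneider1985_order_charGenerator_odd)
    (W : WeierstrassCurve ℚ) [W.IsElliptic] [W.IsGloballyMinimal] {p : ℕ} [Fact p.Prime]
    (hp : p ≠ 2) (hgood : W.HasGoodReductionAtPrime p) (hord : ¬ (p : ℤ) ∣ W.frobeniusTrace p)
    (hrank : W.mordellWeilRank = 0) (hsha : Nat.card (AddCommGroup.primaryComponent W.sha p) = 1)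
    (htors : ¬ p ∣ W.torsionOrder) (htam : ¬ p ∣ W.tamagawaProduct)
    (hNp : ¬ p ∣ W.reductionPointCount p)
    (κ : ZpExtension ℚ p) (hκ : κ.IsCyclotomic) :
    Set.Finite {s : W.selmerInfty κ | p • s = 0} := by
  -- (0) `E(ℚ)`, `Ш[p^∞]`, `Sel_{p^∞}(E/ℚ)` are finite
  haveI hfinE : Finite W.toAffine.Point := W.mordellWeilRank_eq_zero_iff_finite.mp hrank
  haveI hShaFin : Finite (AddCommGroup.primaryComponent W.sha p) :=
    Nat.finite_of_card_ne_zero (by rw [hsha]; exact one_ne_zero)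
  have hcardSel : Nat.card (W.selmerGroupPInfty p) = 1 := by
    rw [W.natCard_selmerGroupPInfty_eq_natCard_primaryComponent_sha p, hsha]
  have hSel : Finite (W.selmerGroupPInfty p) :=
    Nat.finite_of_card_ne_zero (by rw [hcardSel]; exact one_ne_zero)
  -- (1) the normalised cyclotomic pair `(κ₀, γ₀)` and its Iwasawa module `X₀`
  obtain ⟨κ₀, hκ₀, γ₀, hγ₀, hγ₀'⟩ := exists_isCyclotomic_isTopGenerator_isCyclotomicVariable_holds p
  set D₀ : W.SelmerDualData κ₀ γ₀ := W.selmerDualData κ₀ hγ₀ with hD₀def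
  haveI hfg₀ : Module.Finite (IwasawaAlgebra p) D₀.X := D₀.module_finite_of_isCyclotomic W κ₀ hκ₀ hγ₀
  -- (2) `ker g_0` finite at a good ordinary `p`; `X₀` is `Λ`-torsion; a generator `f₀` of `char X₀`
  have hΔ := W.not_dvd_minimalDiscriminantInt_of_hasGoodReductionAtPrime' p hgood
  have hg : Finite (W.KerG κ₀ 0) :=
    W.finite_kerG_zero_of_finite_localTowerKerPrimary_dvd κ₀ fun v hpv ↦
      W.finite_localTowerKerPrimary_zero_of_ordinary hpv hΔ hord κ₀ hκ₀
  haveI : (Module.charIdeal (IwasawaAlgebra p) D₀.X).IsPrincipal := charIdeal_isPrincipal_holds p D₀.X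
  obtain ⟨f₀, hf₀⟩ :=
    Submodule.IsPrincipal.principal (Module.charIdeal (IwasawaAlgebra p) D₀.X)
  have hf₀' : D₀.charIdeal = Ideal.span {f₀} := hf₀
  obtain ⟨-, hX₀, -, -, -, -⟩ :=
    D₀.constantCoeff_charGenerator_mul_natCard_of_finite_selmerGroup_of_ordinary W hγ₀ hSel hg hp
      hgood hord hκ₀ f₀ hf₀
  -- (3) the zero height datum: canonical (no admissible point in rank `0`) with regulator `1`
  let Dh : W.PAdicHeightData p :=
    { pairing := 0, symm := fun _ _ ↦ rfl, map_torsion := fun _ _ _ ↦ rfl }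
  have hDh : Dh.IsCanonical := fun P hP ↦ (hP.1 (isOfFinAddOrder_of_finite P)).elim
  have hReg : padicRegulator Dh = 1 := by
    unfold padicRegulator
    obtain ⟨P, hP⟩ := W.exists_isMordellWeilBasis_holds
    have hex : ∃ (n : ℕ) (P : Fin n → W.toAffine.Point), IsMordellWeilBasis P := ⟨_, P, hP⟩
    rw [dif_pos hex]
    have hn : hex.choose = 0 :=
      (card_eq_mordellWeilRank_of_isMordellWeilBasis_holds W hex.choose_spec.choose_spec).trans hrank
    have hE : IsEmpty (Fin hex.choose) := by rw [hn]; infer_instance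
    unfold padicRegulatorOf
    convert Matrix.det_isEmpty
    exact hE
  have hSch : SchneiderConjecture Dh := by
    change padicRegulator Dh ≠ 0
    rw [hReg]; exact one_ne_zero
  -- (4) clause 3 of the named fact in rank `0`: `f₀(0) · #tors² = u · (1 - α⁻¹)² · #Ш[p^∞] · Reg · Tam`
  obtain ⟨u, hu⟩ :=
    (hPRS W p hp hgood hord κ₀ γ₀ hκ₀ hγ₀ hγ₀' D₀ hX₀ f₀ hf₀' Dh hDh).2.2 hSch hShaFin
  rw [hrank, pow_zero, mul_one, hReg, mul_one, hsha, Nat.cast_one, one_mul] at hu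
  obtain ⟨u₁, hu₁⟩ := exists_unit_one_sub_unitRoot_inv p W ⟨hgood, hord⟩
  rw [hu₁] at hu
  -- norms: every factor but `f₀(0)` is a `p`-adic unit
  have hnu : ∀ v : ℤ_[p]ˣ, ‖((v : ℤ_[p]) : ℚ_[p])‖ = 1 := fun v ↦ by
    rw [PadicInt.padic_norm_e_of_padicInt]; exact PadicInt.isUnit_iff.mp (Units.isUnit v)
  have hnn : ∀ n : ℕ, ¬ p ∣ n → ‖(n : ℚ_[p])‖ = 1 := fun n hn ↦
    Padic.norm_natCast_eq_one_iff.mpr ((Nat.Prime.coprime_iff_not_dvd Fact.out).mpr hn)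
  have hnorm := congrArg (fun z : ℚ_[p] ↦ ‖z‖) hu
  simp only [norm_mul, norm_pow, hnu, hnn _ htors, hnn _ htam, hnn _ hNp, one_pow, mul_one]
    at hnorm
  have hunit : IsUnit (PowerSeries.constantCoeff f₀) := by
    rw [PadicInt.isUnit_iff, ← PowerSeries.coeff_zero_eq_constantCoeff_apply, PadicInt.norm_def]
    exact hnorm
  -- (5) `μ(X₀) = 0`, hence `X₀` finitely generated over `ℤ_p`
  have hμ : muInvariant p D₀.X = 0 :=
    (muInvariant_eq_zero_iff_exists_isUnit_coeff_of_charIdeal_eq_span D₀.X hX₀ hf₀).mpr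
      ⟨0, by rwa [PowerSeries.coeff_zero_eq_constantCoeff_apply]⟩
  letI : Module ℤ_[p] D₀.X := Module.compHom D₀.X (algebraMap ℤ_[p] (IwasawaAlgebra p))
  haveI hfgZp : Module.Finite ℤ_[p] D₀.X :=
    X2.NonPrimitiveSelmerTorsionCard.moduleFinite_int_of_muInvariant_eq_zero p D₀.X hX₀ hμ
  -- (6) `X₀/pX₀` finite ⟹ `Sel_∞[p]` finite (`X₀ = Hom(Sel_∞, ℚ/ℤ)` literally)
  have hmodN : Finite (ModN D₀.X p) := (ZpCorank.natCard_modN_le p D₀.X).1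
  have hmodN' : Finite (ModN (CharacterModule (W.selmerInfty κ₀)) p) := hmodN
  have hcard : Nat.card (ModN (CharacterModule (W.selmerInfty κ₀)) p) =
      Nat.card ((W.selmerInfty κ₀)[(p : ℤ)]) :=
    Iwasawa.natCard_modN_characterModule_eq p (W.selmerInfty κ₀)
  haveI hfinT : Finite ((W.selmerInfty κ₀)[(p : ℤ)]) := by
    apply Nat.finite_of_card_ne_zero
    rw [← hcard]
    exact Nat.card_pos.ne'
  have hfin₀ : Set.Finite {s : W.selmerInfty κ₀ | p • s = 0} := by
    have hset : {s : W.selmerInfty κ₀ | p • s = 0} = (((W.selmerInfty κ₀)[(p : ℤ)] :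
        AddSubgroup (W.selmerInfty κ₀)) : Set (W.selmerInfty κ₀)) := by
      ext s
      rw [Set.mem_setOf_eq, SetLike.mem_coe, AddSubgroup.torsionBy.nsmul_iff]
    rw [hset]
    exact Set.toFinite _
  -- (7) transport to `κ` (`ker κ₀ = ker κ`)
  exact finite_pTorsion_selmerGroupOver_of_eq W (hκ₀.kerSubgroup_eq hκ) hfin₀

/-- Variant with the rank-`0` and `Ш[p^∞]` data read off `ord_{s=1} L(E,s) = 0` and ONE integer:
`r_an(E) = 0` (so `E(ℚ)` and `Ш(E/ℚ)` are finite by Gross–Zagier–Kolyvagin, hypothesis `hGZK`)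
and `p ∤ #Ш(E/ℚ)`; together with `p ∤ #E(ℚ)_tors · ∏ c_ℓ · #Ẽ(𝔽_p)` this is the
printed form of Greenberg's unit data. [cite: GreenbergLNM1716, §4 Thm. 4.1 (p. 85)] -/
theorem finite_selmerInfty_pTorsion_of_analyticRankZero_of_unitData
    (hPRS : Schneider1985_order_charGenerator_odd)
    (hGZK : rank_eq_analyticRank_of_analyticRank_le_one)
    (W : WeierstrassCurve ℚ) [W.IsElliptic] [W.IsGloballyMinimal] {p : ℕ} [Fact p.Prime]
    (hp : p ≠ 2) (hgood : W.HasGoodReductionAtPrime p) (hord : ¬ (p : ℤ) ∣ W.frobeniusTrace p)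
    (hr : W.analyticRank = 0) (hsha : ¬ p ∣ Nat.card W.sha)
    (htors : ¬ p ∣ W.torsionOrder) (htam : ¬ p ∣ W.tamagawaProduct)
    (hNp : ¬ p ∣ W.reductionPointCount p)
    (κ : ZpExtension ℚ p) (hκ : κ.IsCyclotomic) :
    Set.Finite {s : W.selmerInfty κ | p • s = 0} := by
  obtain ⟨hmw, hfin⟩ := hGZK W (by rw [hr]; exact zero_le_one)
  haveI : Finite W.sha := hfin
  have hrank : W.mordellWeilRank = 0 := by rw [hmw, hr]
  -- `p ∤ #Ш ⟹ #Ш[p^∞] = p^{v_p(#Ш)} = 1`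
  have h1 : Nat.card (AddCommGroup.primaryComponent W.sha p) = 1 := by
    rw [card_addPrimaryComponent_eq_pow p, Nat.factorization_eq_zero_of_not_dvd hsha, pow_zero]
  exact finite_selmerInfty_pTorsion_of_unitData hPRS W hp hgood hord hrank h1 htors htam hNp κ hκ

/-! ## §2 The per-row road: Upper at a wild row from ONE congruent good-ordinary unit anchor -/

/-- **The congruence road with a GOOD-ORDINARY UNIT ANCHOR, row form.** Let `W/ℚ` be a row of the
Conj-A crux of route K9: globally minimal, `r_an = 0`, `ClassO6 W 3` (additive, potentially good, wild
at `3`), `W[3]` irreducible. Suppose ONE globally minimal `W′/ℚ` is given with `W′[3] ≃ W[3]` as Galois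
modules (`O6.ModPCongruent W′ W 3`), GOOD ORDINARY at `3`, and the five integers of Greenberg's unit
data: `rank E′(ℚ) = 0`, `#Ш(E′/ℚ)[3^∞] = 1`, `3 ∤ #E′(ℚ)_tors`, `3 ∤ ∏ c_ℓ(E′)`, `3 ∤ #Ẽ′(𝔽₃)`. Then
`ord₃ #Ш(E) ≤ ord₃ #Ш(E)_an` (`MissingUpperBoundAt W 3`) — below the named facts Lim–Sujatha 2018
Prop. 3.2 (`hLS`, p445851), Kato's fine-Selmer reading of 14.5 (3) (`hKatoA`, p420034),
Perrin-Riou–Schneider (`hPRS`), GZK (`hGZK`) and modularity (`hmod`). Chain: unit data ⟹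
`Sel_{3^∞}(E′/ℚ^cyc)[3]` finite (§1) ⟹ (A) at `(E′,3)` ⟹ (A) at `(E,3)` ⟹ Upper (g3's
`WildFineSelmerCongruenceFact.missingUpperBoundAt_wild_of_congruent_of_finite_selmerInfty_pTorsion`).
[cite: LimSujatha2018, §3 Prop. 3.2] [cite: GreenbergLNM1716, §4 Thm. 4.1 (p. 85)]
[cite: Kato2004Asterisque, Thm. 14.5 (3)] -/
theorem missingUpperBoundAt_wild_of_ordinaryUnitAnchor
    (hLS : LimSujatha2018.prop32_fineSelmerDual_moduleFinite_iff_of_torsionIso)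
    (hKatoA :
      Kato2004.rankZero_padicValNat_sha_add_padicValNat_tamagawa_le_of_additive_potGood_of_irreducible_of_fineSelmerDual_fg)
    (hPRS : Schneider1985_order_charGenerator_odd)
    (hGZK : rank_eq_analyticRank_of_analyticRank_le_one) (hmod : hasEntireLFunction_rat)
    (W : WeierstrassCurve ℚ) [W.IsElliptic] [W.IsGloballyMinimal] [Fact (3 : ℕ).Prime]
    (hr : W.analyticRank = 0) (hO : ClassO6 W 3) (hirr : W.HasIrreducibleModPGaloisRep 3)
    (W' : WeierstrassCurve ℚ) [W'.IsElliptic] [W'.IsGloballyMinimal] (hcong : ModPCongruent W' W 3)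
    (hgood' : W'.HasGoodReductionAtPrime 3) (hord' : ¬ (3 : ℤ) ∣ W'.frobeniusTrace 3)
    (hrank' : W'.mordellWeilRank = 0) (hsha' : Nat.card (AddCommGroup.primaryComponent W'.sha 3) = 1)
    (htors' : ¬ 3 ∣ W'.torsionOrder) (htam' : ¬ 3 ∣ W'.tamagawaProduct)
    (hNp' : ¬ 3 ∣ W'.reductionPointCount 3) :
    MissingUpperBoundAt W 3 :=
  WildFineSelmerCongruenceFact.missingUpperBoundAt_wild_of_congruent_of_finite_selmerInfty_pTorsion
    hLS hKatoA hGZK hmod W hr hO hirr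
    ⟨W', ‹W'.IsElliptic›, hcong, fun κ hκ ↦
      finite_selmerInfty_pTorsion_of_unitData hPRS W' (by decide) hgood' hord' hrank' hsha' htors'
        htam' hNp' κ hκ⟩

/-- **The same with the anchor's data in PRINTED form**: `r_an(E′) = 0`, `3 ∤ #Ш(E′/ℚ)`,
`3 ∤ #E′(ℚ)_tors · ∏ c_ℓ(E′) · #Ẽ′(𝔽₃)` (rank `0` and the finiteness of `Ш(E′)` come from GZK).
[cite: LimSujatha2018, §3 Prop. 3.2] [cite: GreenbergLNM1716, §4 Thm. 4.1 (p. 85)] -/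
theorem missingUpperBoundAt_wild_of_ordinaryUnitAnchor_analytic
    (hLS : LimSujatha2018.prop32_fineSelmerDual_moduleFinite_iff_of_torsionIso)
    (hKatoA :
      Kato2004.rankZero_padicValNat_sha_add_padicValNat_tamagawa_le_of_additive_potGood_of_irreducible_of_fineSelmerDual_fg)
    (hPRS : Schneider1985_order_charGenerator_odd)
    (hGZK : rank_eq_analyticRank_of_analyticRank_le_one) (hmod : hasEntireLFunction_rat)
    (W : WeierstrassCurve ℚ) [W.IsElliptic] [W.IsGloballyMinimal] [Fact (3 : ℕ).Prime]
    (hr : W.analyticRank = 0) (hO : ClassO6 W 3) (hirr : W.HasIrreducibleModPGaloisRep 3)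
    (W' : WeierstrassCurve ℚ) [W'.IsElliptic] [W'.IsGloballyMinimal] (hcong : ModPCongruent W' W 3)
    (hgood' : W'.HasGoodReductionAtPrime 3) (hord' : ¬ (3 : ℤ) ∣ W'.frobeniusTrace 3)
    (hr' : W'.analyticRank = 0) (hsha' : ¬ 3 ∣ Nat.card W'.sha)
    (htors' : ¬ 3 ∣ W'.torsionOrder) (htam' : ¬ 3 ∣ W'.tamagawaProduct)
    (hNp' : ¬ 3 ∣ W'.reductionPointCount 3) :
    MissingUpperBoundAt W 3 :=
  WildFineSelmerCongruenceFact.missingUpperBoundAt_wild_of_congruent_of_finite_selmerInfty_pTorsion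
    hLS hKatoA hGZK hmod W hr hO hirr
    ⟨W', ‹W'.IsElliptic›, hcong, fun κ hκ ↦
      finite_selmerInfty_pTorsion_of_analyticRankZero_of_unitData hPRS hGZK W' (by decide) hgood'
        hord' hr' hsha' htors' htam' hNp' κ hκ⟩

/-! ## §3 The crux body from per-row unit-anchor certificates -/

/-- **The body of `WildFineSelmerCoatesSujatha` from per-row GOOD-ORDINARY UNIT-ANCHOR certificates**
(the census currency of seat `bsd-potss-conjA-anchor`): if on every row (wild `3`, `r_an = 0`, `W[3]`
irreducible, tower not onto, no CM) ONE globally minimal `W′` with `W′[3] ≃ W[3]`, good ordinary at `3`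
and Greenberg unit data is given, then Coates–Sujatha's (A) holds at `(W,3)` for every cyclotomic
datum `κ` — below `hLS` and `hPRS` only. (Route-free; elaborates against the route decl by `defeq`.)
[cite: LimSujatha2018, §3 Prop. 3.2] [cite: GreenbergLNM1716, §4 Thm. 4.1 (p. 85)]
[cite: GreenbergVatsal2000, §2 Prop. (2.8)] -/
theorem wildFineSelmerCoatesSujatha_of_unitAnchorCertificates
    (hLS : LimSujatha2018.prop32_fineSelmerDual_moduleFinite_iff_of_torsionIso)
    (hPRS : Schneider1985_order_charGenerator_odd)
    (hcert : ∀ (W : WeierstrassCurve ℚ) [W.IsElliptic] [W.IsGloballyMinimal] [Fact (3 : ℕ).Prime],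
      W.analyticRank = 0 → ClassO6 W 3 → W.HasIrreducibleModPGaloisRep 3 →
      ¬ (∀ n : ℕ, W.HasSurjectiveModNGaloisRep (3 ^ n : ℕ)) → ¬ W.HasCM →
      ∃ (W' : WeierstrassCurve ℚ) (_ : W'.IsElliptic) (_ : W'.IsGloballyMinimal),
        ModPCongruent W' W 3 ∧ W'.HasGoodReductionAtPrime 3 ∧ ¬ (3 : ℤ) ∣ W'.frobeniusTrace 3 ∧
        W'.mordellWeilRank = 0 ∧ Nat.card (AddCommGroup.primaryComponent W'.sha 3) = 1 ∧
        ¬ 3 ∣ W'.torsionOrder ∧ ¬ 3 ∣ W'.tamagawaProduct ∧ ¬ 3 ∣ W'.reductionPointCount 3) :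
    ∀ (W : WeierstrassCurve ℚ) [W.IsElliptic] [W.IsGloballyMinimal] [Fact (3 : ℕ).Prime],
      W.analyticRank = 0 → ClassO6 W 3 → W.HasIrreducibleModPGaloisRep 3 →
      ¬ (∀ n : ℕ, W.HasSurjectiveModNGaloisRep (3 ^ n : ℕ)) → ¬ W.HasCM →
      ∀ (κ : ZpExtension ℚ 3), κ.IsCyclotomic →
        ∃ (γ : Field.absoluteGaloisGroup ℚ) (D : W.FineSelmerDualData κ γ),
          Module.Finite ℤ_[3] (RestrictScalars ℤ_[3] (IwasawaAlgebra 3) D.X) := by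
  refine WildFineSelmerCongruenceFact.wildFineSelmerCoatesSujatha_of_mixedCertificates hLS ?_
  intro W _ _ _ hr hO hirr hns hcm
  obtain ⟨W', _, _, hcong, hgood', hord', hrank', hsha', htors', htam', hNp'⟩ :=
    hcert W hr hO hirr hns hcm
  exact ⟨W', ‹W'.IsElliptic›, hcong, Or.inr fun κ hκ ↦
    finite_selmerInfty_pTorsion_of_unitData hPRS W' (by decide) hgood' hord' hrank' hsha' htors'
      htam' hNp' κ hκ⟩

end Summit.BirchSwinnertonDyer.BirchSwinnertonDyer.Theorems.WildFineSelmerOrdinaryUnitAnchor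

end
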